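import Literature.Geometry.Riemannian.EnergySecondVariationIntegral
import Mathlib.Analysis.Convex.Deriv
import HarnessLib

/-!
# The energy is convex along geodesic homotopies into nonpositively curved targets (Hartman)
(topic `Geometry/Riemannian`)

Hartman 1967 (Canad. J. Math. 19, 673–687), Lemma: for a homotopy `F_t` of maps of a closed
Riemannian manifold into a Riemannian manifold of nonpositive sectional curvature along which
every point moves on a geodesic (`t ↦ F t x` geodesic for each `x` — e.g. `F_t = exp_{F₀}(tV)`),
the energy `t ↦ E(F_t)` is a convex function; this is the source of the uniqueness and
minimising properties of harmonic maps into such targets (Hartman 1967, Thms. (A)–(H);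
Eells–Sampson 1964, §3). With the second-variation formula of
`EnergySecondVariationIntegral.lean` (`hasDerivAt_deriv_energy_stage_eq`: the acceleration term
`−∫ h(D_t∂ₜF, τ)` vanishes for geodesic families, and the remaining integrand is `≥ 0`,
`second_variation_integrand_nonneg`) we PROVE:

* `hasDerivAt_deriv_energy_of_geodesic_family` — along a geodesic family
  `E″(t₀) = ∫ ∑ (𝒢⁻¹)ⱼᵢ [h(D_{sᵢ}V, D_{sⱼ}V) + h(R(V, dF sᵢ)V, dF sⱼ)] dμ_g` at every `t₀`;
* `deriv_deriv_energy_nonneg_of_geodesic_family`, `convexOn_energy_of_geodesic_family` —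
  **`E″ ≥ 0` and `t ↦ E(F_t)` is convex on `ℝ`** for targets of nonpositive curvature;
* `energy_le_of_isHarmonicMap_of_geodesic_family` — a harmonic map minimises the energy along
  every geodesic homotopy through it; `energy_eq_of_isHarmonicMap_of_geodesic_homotopy` —
  **the energy is constant along a geodesic homotopy joining two harmonic maps** (Hartman 1967,
  Thm. (B), first assertion).

Source compact without boundary, modelled on `ℝ^m` (the setting of the divergence theorem);
everything is proved, no definitions, no named facts.

## References

* P. Hartman, *On homotopic harmonic maps*, Canad. J. Math. 19 (1967), 673–687, Lemma and §§4–6.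
  [Hartman1967]
* J. Eells, J. H. Sampson, *Harmonic mappings of Riemannian manifolds*, Amer. J. Math. 86 (1964),
  §3. [EellsSampson1964]
-/

noncomputable section

open Bundle Set Function Filter MeasureTheory
open scoped Manifold ContDiff Topology

namespace Literature.Geometry.Riemannian

open Lorentzian Lorentzian.PseudoRiemannianMetric

namespace HarmonicMap

variable {EN : Type*} [NormedAddCommGroup EN] [NormedSpace ℝ EN] [FiniteDimensional ℝ EN]
  [CompleteSpace EN] {HN : Type*} [TopologicalSpace HN] {IN : ModelWithCorners ℝ EN HN}
  {N : Type*} [TopologicalSpace N] [ChartedSpace HN N] [IsManifold IN ∞ N]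
  (h : PseudoRiemannianMetric IN ∞ EN (TangentSpace IN : N → Type _)) [h.HasLeviCivita]
  {m : ℕ} {HM₂ : Type*} [TopologicalSpace HM₂]
  {IM₂ : ModelWithCorners ℝ (EuclideanSpace ℝ (Fin m)) HM₂} [IM₂.Boundaryless]
  {M₂ : Type*} [TopologicalSpace M₂] [ChartedSpace HM₂ M₂] [IsManifold IM₂ ∞ M₂]
  [CompactSpace M₂] [T3Space M₂] [MeasurableSpace M₂] [BorelSpace M₂]
  (g : ContMDiffRiemannianMetric IM₂ ∞ (EuclideanSpace ℝ (Fin m)) (TangentSpace IM₂ : M₂ → Type _))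
  [(ofRiemannian g).HasLeviCivita]
  {F : ℝ → M₂ → N} (hF : ContMDiff (𝓘(ℝ, ℝ).prod IM₂) IN ∞ (fun p : ℝ × M₂ ↦ F p.1 p.2))
  (hgeo : ∀ (x : M₂) (t : ℝ), covariantDerivAlong h.leviCivita (fun t' ↦ F t' x)
    (fun t' ↦ velocity IN (fun t ↦ F t x) t') t = 0)

include hF hgeo in
/-- **Second variation along a geodesic family**: if every time-curve `t ↦ F t x` is a geodesic
(`D_t ∂ₜF ≡ 0`), the acceleration term of the second-variation formula vanishes and
`E″(t₀) = ∫ ∑ᵢⱼ (𝒢⁻¹)ⱼᵢ [h(D_{sᵢ}V, D_{sⱼ}V) + h(R(V, dF_{t₀} sᵢ)V, dF_{t₀} sⱼ)] dμ_g`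
at every `t₀`. Hartman 1967, proof of the Lemma. [cite: Hartman1967, Lemma] -/
theorem hasDerivAt_deriv_energy_of_geodesic_family (t₀ : ℝ) :
    HasDerivAt (fun t ↦ deriv (fun s ↦ energy g h (F s)) t)
      (∫ x, ∑ i, ∑ j, (Matrix.of fun i j ↦ (ofRiemannian g).val x
            ((trivializationAt (EuclideanSpace ℝ (Fin m)) (TangentSpace IM₂ : M₂ → Type _) x).localFrame
              (Module.finBasis ℝ (EuclideanSpace ℝ (Fin m))) i x)
            ((trivializationAt (EuclideanSpace ℝ (Fin m)) (TangentSpace IM₂ : M₂ → Type _) x).localFrame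
              (Module.finBasis ℝ (EuclideanSpace ℝ (Fin m))) j x))⁻¹ j i *
          (h.val (F t₀ x)
              (h.normalDerivAlong (F t₀) (fun y ↦ velocity IN (fun t ↦ F t y) t₀) x
                ((trivializationAt (EuclideanSpace ℝ (Fin m)) (TangentSpace IM₂ : M₂ → Type _) x).localFrame
                  (Module.finBasis ℝ (EuclideanSpace ℝ (Fin m))) i x))
              (h.normalDerivAlong (F t₀) (fun y ↦ velocity IN (fun t ↦ F t y) t₀) x
                ((trivializationAt (EuclideanSpace ℝ (Fin m)) (TangentSpace IM₂ : M₂ → Type _) x).localFrame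
                  (Module.finBasis ℝ (EuclideanSpace ℝ (Fin m))) j x)) +
            h.val (F t₀ x)
              (h.leviCivita.curvature (F t₀ x) (velocity IN (fun t ↦ F t x) t₀)
                (mfderiv IM₂ IN (F t₀) x ((trivializationAt (EuclideanSpace ℝ (Fin m))
                  (TangentSpace IM₂ : M₂ → Type _) x).localFrame
                    (Module.finBasis ℝ (EuclideanSpace ℝ (Fin m))) i x))
                (velocity IN (fun t ↦ F t x) t₀))
              (mfderiv IM₂ IN (F t₀) x ((trivializationAt (EuclideanSpace ℝ (Fin m))
                (TangentSpace IM₂ : M₂ → Type _) x).localFrame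
                  (Module.finBasis ℝ (EuclideanSpace ℝ (Fin m))) j x)))
        ∂riemannianMeasure g) t₀ := by
  have hd := hasDerivAt_deriv_energy_stage_eq h g hF t₀
  simp only [hgeo, map_zero, zero_apply, sub_zero] at hd
  exact hd

include hF hgeo in
/-- **`E″ ≥ 0` along a geodesic family into a target of nonpositive curvature** (Hartman 1967,
Lemma): `second_variation_integrand_nonneg` integrated. [cite: Hartman1967, Lemma] -/
theorem deriv_deriv_energy_nonneg_of_geodesic_family (hR : h.IsRiemannian)
    (hK : h.HasNonposSectionalCurvature) (t₀ : ℝ) :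
    0 ≤ deriv (fun t ↦ deriv (fun s ↦ energy g h (F s)) t) t₀ := by
  rw [(hasDerivAt_deriv_energy_of_geodesic_family h g hF hgeo t₀).deriv]
  exact integral_nonneg fun x ↦ second_variation_integrand_nonneg h g hR hK hF t₀ x

include hF hgeo in
/-- **Hartman's convexity lemma**: along a geodesic homotopy of maps of a closed Riemannian
manifold into a Riemannian manifold of nonpositive sectional curvature, the energy
`t ↦ E(F_t)` is a convex function on `ℝ` (twice differentiable with nonnegative second
derivative, `convexOn_univ_of_deriv2_nonneg`). Hartman 1967, Lemma (p. 675); Eells–Sampson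
1964, §3. [cite: Hartman1967, Lemma] [cite: EellsSampson1964, §3] -/
theorem convexOn_energy_of_geodesic_family (hR : h.IsRiemannian)
    (hK : h.HasNonposSectionalCurvature) : ConvexOn ℝ univ (fun t ↦ energy g h (F t)) := by
  have h1 : ∀ t, HasDerivAt (fun s ↦ energy g h (F s))
      (∫ x, deriv (fun s ↦ energyDensity g h (F s) x) t ∂riemannianMeasure g) t :=
    fun t ↦ hasDerivAt_energy_family g h hF t
  have hdiff : Differentiable ℝ (fun s ↦ energy g h (F s)) := fun t ↦ (h1 t).differentiableAt
  have hdiff2 : Differentiable ℝ (deriv fun s ↦ energy g h (F s)) := fun t ↦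
    (hasDerivAt_deriv_energy_of_geodesic_family h g hF hgeo t).differentiableAt
  refine convexOn_univ_of_deriv2_nonneg hdiff hdiff2 fun t ↦ ?_
  simpa only [Function.iterate_succ, Function.iterate_zero, Function.comp_apply, id_eq] using
    deriv_deriv_energy_nonneg_of_geodesic_family h g hF hgeo hR hK t

/-! ### Consequences: harmonic maps minimise the energy along geodesic homotopies (Hartman) -/

omit [FiniteDimensional ℝ EN] [CompleteSpace EN] [IsManifold IN ∞ N] [h.HasLeviCivita] [IM₂.Boundaryless]
  [IsManifold IM₂ ∞ M₂] [CompactSpace M₂] [T3Space M₂] [MeasurableSpace M₂] [BorelSpace M₂]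
  [(ofRiemannian g).HasLeviCivita] in
/-- A convex function on `ℝ` with a critical point attains its minimum there (tangent-line
inequalities `ConvexOn.le_slope_of_hasDerivAt`, `ConvexOn.slope_le_of_hasDerivAt`). [folklore] -/
theorem le_of_convexOn_univ_of_hasDerivAt_zero {f : ℝ → ℝ} (hf : ConvexOn ℝ univ f) {a : ℝ}
    (ha : HasDerivAt f 0 a) (t : ℝ) : f a ≤ f t := by
  rcases lt_trichotomy a t with hat | rfl | hta
  · have h1 := hf.le_slope_of_hasDerivAt (mem_univ a) (mem_univ t) hat ha
    rw [slope_def_field] at h1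
    have h2 : 0 ≤ f t - f a := by
      have := mul_nonneg h1 (sub_pos.2 hat).le
      rwa [div_mul_cancel₀ _ (sub_pos.2 hat).ne'] at this
    linarith
  · exact le_rfl
  · have h1 := hf.slope_le_of_hasDerivAt (mem_univ t) (mem_univ a) hta ha
    rw [slope_def_field] at h1
    have h2 : f a - f t ≤ 0 := by
      have := mul_nonpos_iff.2 (Or.inr ⟨h1, (sub_pos.2 hta).le⟩)
      rwa [div_mul_cancel₀ _ (sub_pos.2 hta).ne'] at this
    linarith

include hF hgeo in
/-- **A harmonic map minimises the energy along every geodesic homotopy through it** (Hartman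
1967, §4, the minimising property in the homotopy directions reached by geodesic homotopies):
if `F` is a geodesic family of maps into a Riemannian target of nonpositive sectional curvature
and `F 0` is harmonic, then `E(F 0) ≤ E(F t)` for every `t ∈ ℝ` — the convex function
`t ↦ E(F_t)` (`convexOn_energy_of_geodesic_family`) is critical at `0` (`IsHarmonicMap`).
[cite: Hartman1967, §4] [cite: EellsSampson1964, §3] -/
theorem energy_le_of_isHarmonicMap_of_geodesic_family (hR : h.IsRiemannian)
    (hK : h.HasNonposSectionalCurvature) (hharm : IsHarmonicMap g h (F 0)) (t : ℝ) :
    energy g h (F 0) ≤ energy g h (F t) :=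
  le_of_convexOn_univ_of_hasDerivAt_zero (convexOn_energy_of_geodesic_family h g hF hgeo hR hK)
    (hharm.2 F hF rfl) t

include hF hgeo in
/-- **The energy is constant along a geodesic homotopy joining two harmonic maps** (Hartman
1967, Thm. (B), first assertion: "`E(f_t)` is constant"): if `F` is a geodesic family into a
Riemannian target of nonpositive sectional curvature with `F 0` and `F 1` harmonic, then
`E(F t) = E(F 0)` for all `t ∈ [0, 1]` (both ends minimise the convex function `t ↦ E(F_t)` over
`ℝ`, by `energy_le_of_isHarmonicMap_of_geodesic_family` and its analogue at `t = 1` via the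
shifted deformation `s ↦ F (1 + s)`; convexity between). [cite: Hartman1967, Thm. (B)] -/
theorem energy_eq_of_isHarmonicMap_of_geodesic_homotopy (hR : h.IsRiemannian)
    (hK : h.HasNonposSectionalCurvature) (hharm₀ : IsHarmonicMap g h (F 0))
    (hharm₁ : IsHarmonicMap g h (F 1)) {t : ℝ} (ht : t ∈ Icc (0 : ℝ) 1) :
    energy g h (F t) = energy g h (F 0) := by
  have hconv := convexOn_energy_of_geodesic_family h g hF hgeo hR hK
  -- `E(F 0) ≤ E(F s)` and `E(F 1) ≤ E(F s)` for all `s`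
  have h0 : ∀ s, energy g h (F 0) ≤ energy g h (F s) :=
    energy_le_of_isHarmonicMap_of_geodesic_family h g hF hgeo hR hK hharm₀
  have h1 : ∀ s, energy g h (F 1) ≤ energy g h (F s) := by
    -- the energy is critical at `t = 1`: use the shifted deformation of the harmonic map `F 1`
    have hG : ContMDiff (𝓘(ℝ, ℝ).prod IM₂) IN ∞ (fun p : ℝ × M₂ ↦ F (1 + p.1) p.2) :=
      hF.comp ((contMDiff_const.add contMDiff_fst).prodMk contMDiff_snd)
    have hcrit := hharm₁.2 (fun s x ↦ F (1 + s) x) hG (by funext x; simp)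
    have hshift : HasDerivAt (fun s ↦ energy g h (F s)) 0 1 := by
      -- `E(F s) = (s' ↦ E(F (1 + s'))) (s - 1)`
      have hc : HasDerivAt (fun s : ℝ ↦ s - 1) 1 1 := (hasDerivAt_id 1).sub_const 1
      have hcomp := HasDerivAt.comp_of_eq (h₂ := fun s' ↦ energy g h (fun x ↦ F (1 + s') x))
        (h := fun s : ℝ ↦ s - 1) (x := 1) hcrit hc (by norm_num)
      have heq : ((fun s' ↦ energy g h (fun x ↦ F (1 + s') x)) ∘ fun s : ℝ ↦ s - 1) =
          fun s ↦ energy g h (F s) := by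
        funext s
        simp only [Function.comp_apply, add_sub_cancel]
      rw [heq, zero_mul] at hcomp
      exact hcomp
    exact le_of_convexOn_univ_of_hasDerivAt_zero hconv hshift
  have h01 : energy g h (F 1) = energy g h (F 0) := le_antisymm (h1 0) (h0 1)
  -- convexity on the segment `[0, 1]`
  have hseg : energy g h (F t) ≤ max (energy g h (F 0)) (energy g h (F 1)) :=
    hconv.le_max_of_mem_Icc (mem_univ 0) (mem_univ 1) ht
  rw [h01, max_self] at hseg
  exact le_antisymm hseg (h0 t)

end HarmonicMap

end Literature.Geometry.Riemannian

end
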